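import Mathlib
import Literature.NumberTheory.LFunctions.Zhang2022.Section7I1LineBounds
import Literature.NumberTheory.LFunctions.Zhang2022.Section5VerticalShift
import Literature.NumberTheory.LFunctions.Zhang2022.Section7I1Termwise
import HarnessLib

/-!
# Zhang (2022), §7 p. 35, `Z22:§7.u021`: `I₁(ψ)` = the line integral on `σ = 3/2` with
# `Z(s,ψ)⁻¹ ↦ τ(ψ̄)p^{s−1}ϑ*(1−s)`, up to `O(ε)` — DISCHARGED

Topic `Literature/NumberTheory/LFunctions/Zhang2022` (Landau–Siegel audit tree; verdict-neutral).
Y. Zhang, *Discrete mean estimates and the Landau–Siegel zero*, arXiv:2211.02515v1 (2022)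
[Zhang2022LandauSiegel] — **an unrefereed manuscript under adjudication; nothing here asserts or
denies its Theorems 1–2.** Campaign D-0069 (discharge lane, layer L2); THEOREM-ONLY.

§7 p. 35 (tex L1917–1920), proof of Proposition 7.1, after (7.6):

> Assume `ψ (mod p) ∈ Ψ`. By (2.4), in the integral `I₁(ψ)`, the factor `Z(s,ψ)⁻¹` can be replaced
> by `τ(ψ̄)p^{s−1}ϑ*(1−s)`, and then, by a trivial bound for `ϑ*(1−s)ω(s)` on `σ = 3/2`, the segment
> `𝒥(1)` can be replaced by the line `σ = 3/2`, with negligible errors.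

The typed claim is `Section7bStatements.Step7u021 c′`: for every `B`, some `c > 0`, `C`, all large
`D` under (A), all `𝐚₁, 𝐚₂` with (7.2) (bound `B`) and all `ψ ∈ Ψ`:
`‖I1psi − I1line‖ ≤ C·exp(−c𝓛¹⁰)`. This file PROVES it (`step7u021_holds`, `c = 1/16`,
`C = 34·36·144·e·π²·S·B²`, `S = Σ_m τ₅(m)m^{−5/4}`, `D ≥ ⌈e⁶⁴⌉`; the (A) binder is not used),
and hence also `Z22:§7.u022` outright (`step7u022_holds`, composing sz-d03's landed edge).

Route, made explicit: on `𝒥(1)` (`s = 3/2 + i(2πt₀+v)`, `|v| ≤ 𝓛₁ = 𝓛⁴⁰⁵`, so `Im s ≥ 𝓛⁵¹⁹ ≥ 1`)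
the two exact identities of the tree, (2.5) `Z(s,ψ)⁻¹ = τ(ψ̄)p^{s−1}ϑ(1−s)(1+r)⁻¹`
(`GammaFactor.Zfac_inv_eq`) and (5.5) `ϑ(1−s) = ϑ*(1−s)(1+q)` (`vartheta_one_sub_eq_star_mul`), give
`F = G·(1+q)(1+r)⁻¹` with `|(1+q)(1+r)⁻¹ − 1| ≤ 9e^{−πt} ≤ 9e^{−𝓛⁵¹⁹}` (`segment_integrand_eq`,
`norm_rho_sub_one_le`); the segment integral of `G` is the line integral minus the two tails
`|t − 2πt₀| > 𝓛₁`, each `≤ K₃·8𝓛³⁹⁵e^{−𝓛¹⁰/8}` by the Gaussian majorant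
`‖G(3/2+it)‖ ≤ K₃e^{−(t−2πt₀)²/(8𝓛₂²)}` of `Section7I1LineBounds` (`𝓛₂ = 𝓛⁴⁰⁰`, `𝓛₁²/(8𝓛₂²) = 𝓛¹⁰/8`);
finally `K₃𝓛⁴⁰⁵ ≍ B²P^{5/2}𝓛^{1443}` and `P^{5/2}𝓛^{1443}e^{−𝓛¹⁰/8} ≤ e^{−𝓛¹⁰/16}` for `𝓛 ≥ 64`.

| decl | content |
|---|---|
| `seg_point_eq` | `1 + s₀ + iv = 3/2 + i(2πt₀ + v)` |
| `norm_rho_sub_one_le` | `‖(1+q)(1+r)⁻¹ − 1‖ ≤ 9e^{−πt}` for `t = Im s ≥ 1` |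
| `segment_integrand_eq` | on `Im s > 0`: `Z(s,ψ)⁻¹MAω = (τ(ψ̄)p^{s−1}ϑ*(1−s)MAω)·(1+q)(1+r)⁻¹` |
| `step7u021_holds` | **`Section7bStatements.Step7u021 c′` holds** |
| `step7u022_holds` | **`Section7bStatements.Step7u022 c′` holds** (via the tree's edge `Section7I1Termwise.step7u022_of_step7u021`, sz-d03) |

No fact beyond Mathlib and tree theorems is used (FACT-LIST F-06/F-07/F-09 via the tree's `GammaFactor`
and Γ-bound files).

## References

* Y. Zhang, arXiv:2211.02515v1 (2022), §7 (7.6) p. 35, tex L1917–1920; §2 (2.4)–(2.5); §5 (5.5).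
  [cite: Zhang2022LandauSiegel, §7 p.35 tex L1920]
-/

noncomputable section

open Complex Real MeasureTheory Set Filter

namespace Literature.NumberTheory.LFunctions.Zhang2022.Section7I1Line

open Skeleton Section7bStatements

variable (c' : ℝ)

/-! ## The segment `𝒥(1)` as a piece of the line `σ = 3/2` -/

/-- `1 + s₀ + iv = 3/2 + i(2πt₀ + v)` (`s₀ = 1/2 + 2πit₀`): the segment `𝒥(1)` lies on `σ = 3/2`.
[cite: Zhang2022LandauSiegel, §7 p. 33 (definition of `𝒥(z)`)] -/
theorem seg_point_eq (D : ℕ) (v : ℝ) :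
    (1 : ℂ) + SmoothWeight.s0 (t0 D) + (v : ℂ) * I =
      (3 / 2 : ℂ) + ((2 * π * t0 D + v : ℝ) : ℂ) * I := by
  rw [SmoothWeight.s0_def]
  push_cast
  ring

/-- **The replacement factor** `ρ = (1+q)(1+r)⁻¹` of (2.5)+(5.5) is `1 + O(e^{−πt})`: for `t = Im s ≥ 1`,
`‖(1 + q)(1 + r)⁻¹ − 1‖ ≤ 9e^{−πt}` (`|q| = e^{−πt}`, `|(1+r)⁻¹ − 1| ≤ 6e^{−πt}`, `|(1+r)⁻¹| ≤ 3`).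
[cite: Zhang2022LandauSiegel, §2 (2.5); §5 (5.5)] -/
theorem norm_rho_sub_one_le {k : ℕ} [NeZero k] (θ : DirichletCharacter ℂ k) {s : ℂ}
    (hs : 1 ≤ s.im) :
    ‖(1 + GammaFactor.qexp s) * (1 + GammaFactor.corr θ s)⁻¹ - 1‖ ≤ 9 * Real.exp (-π * s.im) := by
  have h1 := GammaFactor.norm_inv_one_add_corr_sub_one_le θ hs
  have h2 : ‖GammaFactor.qexp s‖ = Real.exp (-π * s.im) := GammaFactor.norm_qexp s
  have h3 : Real.exp (-π * s.im) ≤ 1 / 3 := GammaFactor.exp_neg_pi_mul_le hs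
  have hE : 0 ≤ Real.exp (-π * s.im) := (Real.exp_pos _).le
  have hinv : ‖(1 + GammaFactor.corr θ s)⁻¹‖ ≤ 3 := by
    have := norm_le_norm_add_norm_sub' ((1 + GammaFactor.corr θ s)⁻¹) (1 : ℂ)
    -- ‖a‖ ≤ ‖1‖ + ‖a − 1‖
    calc ‖(1 + GammaFactor.corr θ s)⁻¹‖
        ≤ ‖(1 : ℂ)‖ + ‖(1 + GammaFactor.corr θ s)⁻¹ - 1‖ := norm_le_insert' _ _
      _ ≤ 1 + 6 * Real.exp (-π * s.im) := by rw [norm_one]; exact add_le_add le_rfl h1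
      _ ≤ 3 := by linarith
  have e : (1 + GammaFactor.qexp s) * (1 + GammaFactor.corr θ s)⁻¹ - 1 =
      ((1 + GammaFactor.corr θ s)⁻¹ - 1) + GammaFactor.qexp s * (1 + GammaFactor.corr θ s)⁻¹ := by
    ring
  rw [e]
  calc ‖((1 + GammaFactor.corr θ s)⁻¹ - 1) + GammaFactor.qexp s * (1 + GammaFactor.corr θ s)⁻¹‖
      ≤ ‖(1 + GammaFactor.corr θ s)⁻¹ - 1‖ + ‖GammaFactor.qexp s * (1 + GammaFactor.corr θ s)⁻¹‖ :=
        norm_add_le _ _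
    _ ≤ 6 * Real.exp (-π * s.im) + Real.exp (-π * s.im) * 3 := by
        rw [norm_mul, h2]
        exact add_le_add h1 (mul_le_mul_of_nonneg_left hinv hE)
    _ = 9 * Real.exp (-π * s.im) := by ring

variable {D : ℕ}

/-- **The integrand of `I₁(ψ)` against the modified integrand**, EXACT (tex L1920, "By (2.4) …
`Z(s,ψ)⁻¹` can be replaced by `τ(ψ̄)p^{s−1}ϑ*(1−s)`"): for `ψ (mod p) ∈ Ψ` and `Im s > 0`,
`Z(s,ψ)⁻¹·M(s)A(1−s)ω(s) = (τ(ψ̄)p^{s−1}ϑ*(1−s)·M(s)A(1−s)ω(s))·(1+q)(1+r)⁻¹`, by (2.5)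
(`GammaFactor.Zfac_inv_eq`) and (5.5) (`GammaFactor.vartheta_one_sub_eq_star_mul`).
[cite: Zhang2022LandauSiegel, §7 p. 35, tex L1920] -/
theorem segment_integrand_eq (x : Chr D) (a₁ a₂ : ℕ → ℂ) {s : ℂ} (hs : 0 < s.im) :
    (GammaFactor.Zfac x.ψ s)⁻¹ *
        LSeries (fun m => kappaConv c' D a₁ m * x.ψ (m : ZMod x.p)) s *
        ApolyBar x a₂ (1 - s) * omegaW D s =
      (GammaFactor.tau x.ψ⁻¹ * (x.p : ℂ) ^ (s - 1) * GammaFactor.varthetaStarOneSub s *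
        LSeries (fun m => kappaConv c' D a₁ m * x.ψ (m : ZMod x.p)) s *
        ApolyBar x a₂ (1 - s) * omegaW D s) *
      ((1 + GammaFactor.qexp s) * (1 + GammaFactor.corr x.ψ s)⁻¹) := by
  haveI : NeZero x.p := ⟨x.prime.ne_zero⟩
  rw [GammaFactor.Zfac_inv_eq x.prim hs, GammaFactor.vartheta_one_sub_eq_star_mul s]
  ring

/-- **Size of the replacement error on the segment**: for `ψ (mod p) ∈ Ψ` and `Im s ≥ 1`,
`‖Z(s,ψ)⁻¹MAω − GMAω‖ ≤ ‖GMAω‖·9e^{−π Im s}` (notation of `segment_integrand_eq`).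
[cite: Zhang2022LandauSiegel, §7 p. 35, tex L1920] -/
theorem norm_segment_integrand_sub_le (x : Chr D) (a₁ a₂ : ℕ → ℂ) {s : ℂ} (hs : 1 ≤ s.im) :
    ‖(GammaFactor.Zfac x.ψ s)⁻¹ *
          LSeries (fun m => kappaConv c' D a₁ m * x.ψ (m : ZMod x.p)) s *
          ApolyBar x a₂ (1 - s) * omegaW D s -
        GammaFactor.tau x.ψ⁻¹ * (x.p : ℂ) ^ (s - 1) * GammaFactor.varthetaStarOneSub s *
          LSeries (fun m => kappaConv c' D a₁ m * x.ψ (m : ZMod x.p)) s *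
          ApolyBar x a₂ (1 - s) * omegaW D s‖ ≤
      ‖GammaFactor.tau x.ψ⁻¹ * (x.p : ℂ) ^ (s - 1) * GammaFactor.varthetaStarOneSub s *
          LSeries (fun m => kappaConv c' D a₁ m * x.ψ (m : ZMod x.p)) s *
          ApolyBar x a₂ (1 - s) * omegaW D s‖ * (9 * Real.exp (-π * s.im)) := by
  haveI : NeZero x.p := ⟨x.prime.ne_zero⟩
  rw [segment_integrand_eq c' x a₁ a₂ (lt_of_lt_of_le one_pos hs)]
  set G := GammaFactor.tau x.ψ⁻¹ * (x.p : ℂ) ^ (s - 1) * GammaFactor.varthetaStarOneSub s *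
    LSeries (fun m => kappaConv c' D a₁ m * x.ψ (m : ZMod x.p)) s *
    ApolyBar x a₂ (1 - s) * omegaW D s with hG
  have e : G * ((1 + GammaFactor.qexp s) * (1 + GammaFactor.corr x.ψ s)⁻¹) - G =
      G * ((1 + GammaFactor.qexp s) * (1 + GammaFactor.corr x.ψ s)⁻¹ - 1) := by ring
  rw [e, norm_mul]
  exact mul_le_mul_of_nonneg_left (norm_rho_sub_one_le x.ψ hs) (norm_nonneg _)

/-- **Continuity of the integrand of `I₁(ψ)` along the segment** `v ↦ 1 + s₀ + iv` on `v > −2πt₀`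
(there `Im s > 0`, so `Z(s,ψ)` is analytic and non-zero: `GammaFactor.differentiableAt_Zfac`,
`GammaFactor.Zfac_ne_zero`). [cite: Zhang2022LandauSiegel, §7 (7.6) p. 35] -/
theorem continuousAt_segment_integrand (x : Chr D) {B : ℝ} {a₁ : ℕ → ℂ} (ha₁ : ∀ n, ‖a₁ n‖ ≤ B)
    (a₂ : ℕ → ℂ) {v : ℝ} (hv : 0 < 2 * π * t0 D + v) :
    ContinuousAt (fun v : ℝ =>
      (GammaFactor.Zfac x.ψ ((1 : ℂ) + SmoothWeight.s0 (t0 D) + (v : ℂ) * I))⁻¹ *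
        LSeries (fun m => kappaConv c' D a₁ m * x.ψ (m : ZMod x.p))
          ((1 : ℂ) + SmoothWeight.s0 (t0 D) + (v : ℂ) * I) *
        ApolyBar x a₂ (1 - ((1 : ℂ) + SmoothWeight.s0 (t0 D) + (v : ℂ) * I)) *
        omegaW D ((1 : ℂ) + SmoothWeight.s0 (t0 D) + (v : ℂ) * I)) v := by
  haveI : NeZero x.p := ⟨x.prime.ne_zero⟩
  -- rewrite the segment points as points of the line `σ = 3/2` at height `2πt₀ + v`
  have hfun : (fun v : ℝ =>
      (GammaFactor.Zfac x.ψ ((1 : ℂ) + SmoothWeight.s0 (t0 D) + (v : ℂ) * I))⁻¹ *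
        LSeries (fun m => kappaConv c' D a₁ m * x.ψ (m : ZMod x.p))
          ((1 : ℂ) + SmoothWeight.s0 (t0 D) + (v : ℂ) * I) *
        ApolyBar x a₂ (1 - ((1 : ℂ) + SmoothWeight.s0 (t0 D) + (v : ℂ) * I)) *
        omegaW D ((1 : ℂ) + SmoothWeight.s0 (t0 D) + (v : ℂ) * I)) =
      (fun t : ℝ => (GammaFactor.Zfac x.ψ ((3 / 2 : ℂ) + t * I))⁻¹ *
        LSeries (fun m => kappaConv c' D a₁ m * x.ψ (m : ZMod x.p)) ((3 / 2 : ℂ) + t * I) *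
        ApolyBar x a₂ (1 - ((3 / 2 : ℂ) + t * I)) * omegaW D ((3 / 2 : ℂ) + t * I)) ∘
      (fun v : ℝ => 2 * π * t0 D + v) := by
    ext v
    simp only [Function.comp_apply, seg_point_eq]
  rw [hfun]
  have hshift : Continuous fun v : ℝ => 2 * π * t0 D + v := by fun_prop
  refine ContinuousAt.comp (f := fun v : ℝ => 2 * π * t0 D + v) ?_ hshift.continuousAt
  set t : ℝ := 2 * π * t0 D + v with ht
  have him : 0 < ((3 / 2 : ℂ) + (t : ℂ) * I).im := by simp; exact hv
  -- `Z(s,ψ)⁻¹` is continuous at the point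
  have hZ : ContinuousAt (fun t : ℝ => (GammaFactor.Zfac x.ψ ((3 / 2 : ℂ) + t * I))⁻¹) t := by
    have hline : Continuous fun t : ℝ => (3 / 2 : ℂ) + (t : ℂ) * I := by fun_prop
    have h1 : ContinuousAt (GammaFactor.Zfac x.ψ) ((3 / 2 : ℂ) + (t : ℂ) * I) :=
      (GammaFactor.differentiableAt_Zfac x.ψ him).continuousAt
    have h2 : ContinuousAt (fun t : ℝ => GammaFactor.Zfac x.ψ ((3 / 2 : ℂ) + t * I)) t :=
      ContinuousAt.comp (f := fun t : ℝ => (3 / 2 : ℂ) + (t : ℂ) * I) h1 hline.continuousAt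
    exact h2.inv₀ (GammaFactor.Zfac_ne_zero x.prim him)
  have hM := (continuous_lseries_line c' x ha₁).continuousAt (x := t)
  have hA := (continuous_ApolyBar_line x a₂).continuousAt (x := t)
  have hω := (Section7I1Kernel.continuous_omega_line D).continuousAt (x := t)
  exact ((hZ.mul hM).mul hA).mul hω

/-! ## The exponent bookkeeping -/

/-- For `𝓛 ≥ 64`: `P^{5/2}·𝓛¹⁴⁴³·e^{−𝓛¹⁰/8} ≤ e^{−𝓛¹⁰/16}` (`P = e^{𝓛⁹}`, `𝓛¹⁴⁴³ ≤ e^{1443𝓛}`,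
`5𝓛⁹/2 + 1443𝓛 ≤ 4𝓛⁹ ≤ 𝓛¹⁰/16`). [cite: Zhang2022LandauSiegel, §7 p. 35, tex L1920] -/
private theorem prefactor_le {D : ℕ} (hℓ : 64 ≤ ell D) :
    bigP D ^ (5 / 2 : ℝ) * ell D ^ 1443 * Real.exp (-(ell D ^ 10) / 8) ≤
      Real.exp (-(1 / 16) * ell D ^ 10) := by
  have hℓ1 : (1 : ℝ) ≤ ell D := by linarith
  have hℓ0 : (0 : ℝ) < ell D := by linarith
  have hP : bigP D ^ (5 / 2 : ℝ) = Real.exp (ell D ^ 9 * (5 / 2)) := by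
    rw [bigP, ← Real.exp_mul]
  have hpoly_pos : 0 < ell D ^ 1443 := by positivity
  have hpoly : ell D ^ 1443 = Real.exp (Real.log (ell D ^ 1443)) := (Real.exp_log hpoly_pos).symm
  have hlog : Real.log (ell D ^ 1443) ≤ 1443 * ell D := by
    rw [Real.log_pow]
    have hl : Real.log (ell D) ≤ ell D := by
      have := Real.log_le_sub_one_of_pos hℓ0; linarith
    push_cast
    nlinarith
  have h8 : (4096 : ℝ) ≤ ell D ^ 2 := by nlinarith
  have h8' : ell D ^ 2 ≤ ell D ^ 8 := pow_le_pow_right₀ hℓ1 (by norm_num)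
  have h9 : 1443 * ell D ≤ ell D ^ 9 := by
    have e : ell D ^ 9 = ell D ^ 8 * ell D := by ring
    rw [e]; nlinarith
  have h10 : 64 * ell D ^ 9 ≤ ell D ^ 10 := by
    have e : ell D ^ 10 = ell D * ell D ^ 9 := by ring
    have : 0 ≤ ell D ^ 9 := by positivity
    rw [e]; nlinarith
  have key : ell D ^ 9 * (5 / 2) + Real.log (ell D ^ 1443) + -(ell D ^ 10) / 8 ≤
      -(1 / 16) * ell D ^ 10 := by nlinarith
  calc bigP D ^ (5 / 2 : ℝ) * ell D ^ 1443 * Real.exp (-(ell D ^ 10) / 8)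
      = Real.exp (ell D ^ 9 * (5 / 2) + Real.log (ell D ^ 1443) + -(ell D ^ 10) / 8) := by
        rw [hP, Real.exp_add, Real.exp_add, Real.exp_log hpoly_pos]
    _ ≤ Real.exp (-(1 / 16) * ell D ^ 10) := Real.exp_le_exp.mpr key

/-- The size of the constant `K₃` of the Gaussian majorant: for `D ≥ 9` and `ψ (mod p) ∈ Ψ`,
`16π²S·B²·p·(P/T²)^{3/2}·(√π/𝓛₂)·(e·144𝓛¹⁰³⁸) ≤ 36·144·e·π²·S·B²·P^{5/2}·𝓛¹⁰³⁸`
(`p ≤ 9P/8`, `(P/T²)^{3/2} ≤ P^{3/2}`, `√π/𝓛₂ ≤ 2`). [cite: Zhang2022LandauSiegel, §7 p. 35, tex L1920] -/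
private theorem K3_le {D : ℕ} (hD : 9 ≤ D) (x : Chr D) {S B : ℝ} (hS : 0 ≤ S) :
    (16 * π ^ 2 * S * B ^ 2 * (x.p : ℝ) * (bigP D / bigT D ^ 2) ^ (3 / 2 : ℝ) *
        (Real.sqrt π / ell2 D)) * (Real.exp 1 * (144 * ell D ^ 1038)) ≤
      36 * 144 * Real.exp 1 * π ^ 2 * S * B ^ 2 * bigP D ^ (5 / 2 : ℝ) * ell D ^ 1038 := by
  have hℓ := Section6TailBounds.two_le_ell hD
  have hP : 0 < bigP D := Real.exp_pos _
  have hT1 : 1 ≤ bigT D := Real.one_le_exp (Real.rpow_nonneg (Real.log_natCast_nonneg D) _)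
  obtain ⟨_, hp2⟩ := Section6TailBounds.p_range hD x
  have hℓ₂1 : 1 ≤ ell2 D := by rw [ell2]; exact one_le_pow₀ (by linarith)
  -- `(P/T²)^{3/2} ≤ P^{3/2}`
  have hPT : (bigP D / bigT D ^ 2) ^ (3 / 2 : ℝ) ≤ bigP D ^ (3 / 2 : ℝ) := by
    apply Real.rpow_le_rpow (by positivity) _ (by norm_num)
    rw [div_le_iff₀ (by positivity)]
    have : 1 ≤ bigT D ^ 2 := one_le_pow₀ hT1
    nlinarith
  -- `√π/𝓛₂ ≤ 2`
  have hsq : Real.sqrt π / ell2 D ≤ 2 := by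
    have h1 : Real.sqrt π ≤ 2 := by
      rw [Real.sqrt_le_left (by norm_num)]
      linarith [Real.pi_lt_four]
    calc Real.sqrt π / ell2 D ≤ Real.sqrt π / 1 :=
          div_le_div_of_nonneg_left (Real.sqrt_nonneg _) one_pos hℓ₂1
      _ ≤ 2 := by rw [div_one]; exact h1
  -- `p · P^{3/2} ≤ (9/8) P^{5/2}`
  have hP52 : bigP D * bigP D ^ (3 / 2 : ℝ) = bigP D ^ (5 / 2 : ℝ) := by
    rw [show (5 / 2 : ℝ) = 1 + 3 / 2 by norm_num, Real.rpow_add hP, Real.rpow_one]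
  have h0 : 0 ≤ 16 * π ^ 2 * S * B ^ 2 := by positivity
  have hP32 : 0 ≤ bigP D ^ (3 / 2 : ℝ) := Real.rpow_nonneg hP.le _
  calc (16 * π ^ 2 * S * B ^ 2 * (x.p : ℝ) * (bigP D / bigT D ^ 2) ^ (3 / 2 : ℝ) *
        (Real.sqrt π / ell2 D)) * (Real.exp 1 * (144 * ell D ^ 1038))
      = (16 * π ^ 2 * S * B ^ 2) * ((x.p : ℝ) * (bigP D / bigT D ^ 2) ^ (3 / 2 : ℝ) *
          (Real.sqrt π / ell2 D)) * (Real.exp 1 * (144 * ell D ^ 1038)) := by ring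
    _ ≤ (16 * π ^ 2 * S * B ^ 2) * ((9 / 8 * bigP D) * bigP D ^ (3 / 2 : ℝ) * 2) *
          (Real.exp 1 * (144 * ell D ^ 1038)) := by
        gcongr
    _ = 36 * 144 * Real.exp 1 * π ^ 2 * S * B ^ 2 * (bigP D * bigP D ^ (3 / 2 : ℝ)) *
          ell D ^ 1038 := by ring
    _ = 36 * 144 * Real.exp 1 * π ^ 2 * S * B ^ 2 * bigP D ^ (5 / 2 : ℝ) * ell D ^ 1038 := by
        rw [hP52]

/-! ## `Z22:§7.u021` -/

/-- **`Z22:§7.u021` DISCHARGED** (§7 p. 35, tex L1920): `Section7bStatements.Step7u021 c′` HOLDS —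
for every `B`: with `c = 1/16`, `C = 34·36·144·e·π²·S·B²` (`S = Σ_m τ₅(m)m^{−5/4}`) and all
`D ≥ ⌈e⁶⁴⌉`, all `𝐚₁, 𝐚₂` satisfying (7.2) with bound `B`, all `ψ ∈ Ψ`:
`‖I₁(ψ) − I1line‖ ≤ C e^{−𝓛¹⁰/16}`. The Assumption (A) binder is not used.
[cite: Zhang2022LandauSiegel, §7 p. 35, tex L1920] -/
theorem step7u021_holds : Step7u021 c' := by
  intro B
  refine ⟨1 / 16, by norm_num,
    34 * 36 * 144 * Real.exp 1 * π ^ 2 *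
      (∑' m : ℕ, MeanSquareMajorant.tau 5 m * (m : ℝ) ^ (-(5 / 4 : ℝ))) * B ^ 2,
    ⌈Real.exp 64⌉₊, fun D _ χ hD _ _ _ a₁ a₂ ha₁ ha₂ x => ?_⟩
  -- parameters
  have hexpD : Real.exp 64 ≤ (D : ℝ) := le_trans (Nat.le_ceil _) (by exact_mod_cast hD)
  have hDpos : (0 : ℝ) < D := lt_of_lt_of_le (Real.exp_pos _) hexpD
  have hℓ64 : 64 ≤ ell D := by rw [ell, Real.le_log_iff_exp_le hDpos]; exact hexpD
  have hD9 : 9 ≤ D := by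
    have h65 : (64 : ℝ) + 1 ≤ Real.exp 64 := Real.add_one_le_exp _
    have : ((9 : ℕ) : ℝ) ≤ (D : ℝ) := by push_cast; linarith
    exact_mod_cast this
  have hℓ := Section6TailBounds.two_le_ell hD9
  have hℓ0 : 0 < ell D := by linarith
  haveI : NeZero x.p := ⟨x.prime.ne_zero⟩
  have hB : 0 ≤ B := (norm_nonneg _).trans (ha₁.1 0)
  set S : ℝ := ∑' m : ℕ, MeanSquareMajorant.tau 5 m * (m : ℝ) ^ (-(5 / 4 : ℝ)) with hS
  have hS0 : 0 ≤ S := tsum_nonneg fun m => mul_nonneg (MeanSquareMajorant.tau_nonneg 5 m)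
    (Real.rpow_nonneg (Nat.cast_nonneg m) _)
  -- the two integrands
  set G : ℝ → ℂ := fun t =>
    GammaFactor.tau x.ψ⁻¹ * (x.p : ℂ) ^ (((3 / 2 : ℂ) + t * I) - 1) *
      GammaFactor.varthetaStarOneSub ((3 / 2 : ℂ) + t * I) *
      LSeries (fun m => kappaConv c' D a₁ m * x.ψ (m : ZMod x.p)) ((3 / 2 : ℂ) + t * I) *
      ApolyBar x a₂ (1 - ((3 / 2 : ℂ) + t * I)) * omegaW D ((3 / 2 : ℂ) + t * I) with hGdef
  set F : ℝ → ℂ := fun v =>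
    (GammaFactor.Zfac x.ψ ((1 : ℂ) + SmoothWeight.s0 (t0 D) + (v : ℂ) * I))⁻¹ *
      LSeries (fun m => kappaConv c' D a₁ m * x.ψ (m : ZMod x.p))
        ((1 : ℂ) + SmoothWeight.s0 (t0 D) + (v : ℂ) * I) *
      ApolyBar x a₂ (1 - ((1 : ℂ) + SmoothWeight.s0 (t0 D) + (v : ℂ) * I)) *
      omegaW D ((1 : ℂ) + SmoothWeight.s0 (t0 D) + (v : ℂ) * I) with hFdef
  set c : ℝ := 2 * π * t0 D with hc
  set L₁ : ℝ := ell1 D with hL₁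
  have hI1psi : I1psi c' x a₁ a₂ = (1 / (2 * π) : ℂ) * ∫ v in (-L₁)..L₁, F v := rfl
  have hI1line : I1line c' x a₁ a₂ = 1 / (2 * π) * ∫ t : ℝ, G t := rfl
  have hL₁0 : 0 ≤ L₁ := by rw [hL₁, ell1]; positivity
  have hcL : ell D ^ 519 ≤ c - L₁ := by
    rw [hc, hL₁, t0, ell1]
    have h405 : ell D ^ 405 ≤ ell D ^ 519 := Section6TailBounds.ell_pow_le_pow hD9 (by norm_num)
    nlinarith [Real.pi_gt_three, pow_pos hℓ0 519]
  have h519 : (1 : ℝ) ≤ ell D ^ 519 := one_le_pow₀ (by linarith)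
  -- integrability and the Gaussian majorant of `G`
  have hGint : Integrable G := integrable_lineIntegrand c' hD9 x ha₁.1 ha₂
  set K₃ : ℝ := (16 * π ^ 2 * S * B ^ 2 * (x.p : ℝ) * (bigP D / bigT D ^ 2) ^ (3 / 2 : ℝ) *
    (Real.sqrt π / ell2 D)) * (Real.exp 1 * (144 * ell D ^ 1038)) with hK₃
  have hℓ₂ : 0 < ell2 D := by rw [ell2]; positivity
  have hK₃0 : 0 ≤ K₃ := by
    have h1 : 0 ≤ (bigP D / bigT D ^ 2) ^ (3 / 2 : ℝ) := by
      apply Real.rpow_nonneg; rw [bigP, bigT]; positivity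
    have h2 : 0 ≤ Real.sqrt π / ell2 D := div_nonneg (Real.sqrt_nonneg _) hℓ₂.le
    have hp0 : (0 : ℝ) ≤ x.p := Nat.cast_nonneg _
    have h16 : (0 : ℝ) ≤ 16 * π ^ 2 := by positivity
    have h3 : 0 ≤ 16 * π ^ 2 * S * B ^ 2 * (x.p : ℝ) :=
      mul_nonneg (mul_nonneg (mul_nonneg h16 hS0) (sq_nonneg B)) hp0
    have h4 : 0 ≤ Real.exp 1 * (144 * ell D ^ 1038) :=
      mul_nonneg (Real.exp_pos _).le (mul_nonneg (by norm_num) (pow_nonneg hℓ0.le _))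
    rw [hK₃]
    exact mul_nonneg (mul_nonneg (mul_nonneg h3 h1) h2) h4
  have hGbd : ∀ t : ℝ, ‖G t‖ ≤ K₃ * Real.exp (-(1 / (8 * ell2 D ^ 2)) * (t - c) ^ 2) :=
    fun t => norm_lineIntegrand_le_gauss c' hD9 x ha₁.1 ha₂ t
  -- pointwise on the segment: `F(v) − G(v+c)` is tiny
  have hseg : ∀ v ∈ Set.uIoc (-L₁) L₁, ‖F v - G (v + c)‖ ≤ 9 * K₃ * Real.exp (-(ell D ^ 519)) := by
    intro v hv
    rw [Set.uIoc_of_le (by linarith : -L₁ ≤ L₁)] at hv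
    have hv1 : -L₁ < v := hv.1
    set s : ℂ := (3 / 2 : ℂ) + ((v + c : ℝ) : ℂ) * I with hs
    have hsF : (1 : ℂ) + SmoothWeight.s0 (t0 D) + (v : ℂ) * I = s := by
      rw [hs, seg_point_eq, hc]; push_cast; ring
    have him : s.im = v + c := by simp [hs]
    have him1 : 1 ≤ s.im := by rw [him]; linarith
    have hFv : F v = (GammaFactor.Zfac x.ψ s)⁻¹ *
        LSeries (fun m => kappaConv c' D a₁ m * x.ψ (m : ZMod x.p)) s *
        ApolyBar x a₂ (1 - s) * omegaW D s := by
      simp only [hFdef, hsF]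
    have hGv : G (v + c) = GammaFactor.tau x.ψ⁻¹ * (x.p : ℂ) ^ (s - 1) *
        GammaFactor.varthetaStarOneSub s *
        LSeries (fun m => kappaConv c' D a₁ m * x.ψ (m : ZMod x.p)) s *
        ApolyBar x a₂ (1 - s) * omegaW D s := by
      simp only [hGdef, hs]
    have hGs : ‖GammaFactor.tau x.ψ⁻¹ * (x.p : ℂ) ^ (s - 1) * GammaFactor.varthetaStarOneSub s *
        LSeries (fun m => kappaConv c' D a₁ m * x.ψ (m : ZMod x.p)) s *
        ApolyBar x a₂ (1 - s) * omegaW D s‖ ≤ K₃ := by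
      have h1 := hGbd (v + c)
      rw [hGv] at h1
      have hE : Real.exp (-(1 / (8 * ell2 D ^ 2)) * (v + c - c) ^ 2) ≤ 1 := by
        apply Real.exp_le_one_iff.mpr
        have h1 : 0 ≤ 1 / (8 * ell2 D ^ 2) :=
          div_nonneg zero_le_one (mul_nonneg (by norm_num) (pow_nonneg hℓ₂.le 2))
        have h2 := mul_nonneg h1 (sq_nonneg (v + c - c))
        linarith
      calc _ ≤ K₃ * Real.exp (-(1 / (8 * ell2 D ^ 2)) * (v + c - c) ^ 2) := h1
        _ ≤ K₃ * 1 := mul_le_mul_of_nonneg_left hE hK₃0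
        _ = K₃ := mul_one _
    have hexp : 9 * Real.exp (-π * s.im) ≤ 9 * Real.exp (-(ell D ^ 519)) := by
      apply mul_le_mul_of_nonneg_left _ (by norm_num)
      apply Real.exp_le_exp.mpr
      rw [him]
      have : ell D ^ 519 ≤ v + c := by linarith
      nlinarith [Real.pi_gt_three]
    rw [hFv, hGv]
    calc _ ≤ _ := norm_segment_integrand_sub_le c' x a₁ a₂ (s := s) him1
      _ ≤ K₃ * (9 * Real.exp (-(ell D ^ 519))) :=
          mul_le_mul hGs hexp (by positivity) hK₃0
      _ = 9 * K₃ * Real.exp (-(ell D ^ 519)) := by ring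
  -- interval integrability on the segment
  have hFcont : ContinuousOn F (Set.uIcc (-L₁) L₁) := by
    intro v hv
    rw [Set.uIcc_of_le (by linarith : -L₁ ≤ L₁)] at hv
    have hpos : 0 < 2 * π * t0 D + v := by
      have : ell D ^ 519 ≤ c + v := by linarith [hv.1]
      rw [hc] at this; linarith
    exact (continuousAt_segment_integrand c' x ha₁.1 a₂ hpos).continuousWithinAt
  have hFi : IntervalIntegrable F volume (-L₁) L₁ := hFcont.intervalIntegrable
  have hGshift_cont : Continuous fun v : ℝ => G (v + c) :=
    (continuous_lineIntegrand c' x ha₁.1 a₂).comp (continuous_id.add continuous_const)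
  have hGi : IntervalIntegrable (fun v : ℝ => G (v + c)) volume (-L₁) L₁ :=
    hGshift_cont.intervalIntegrable _ _
  have hsegInt : ‖(∫ v in (-L₁)..L₁, F v) - ∫ v in (-L₁)..L₁, G (v + c)‖ ≤
      9 * K₃ * Real.exp (-(ell D ^ 519)) * |L₁ - (-L₁)| := by
    rw [← intervalIntegral.integral_sub hFi hGi]
    exact intervalIntegral.norm_integral_le_of_norm_le_const hseg
  -- the line integral splits into the segment and the two tails
  have hsplit : ∫ t : ℝ, G t = (∫ t in Set.Iic (c - L₁), G t) +
      ((∫ v in (-L₁)..L₁, G (v + c)) + ∫ t in Set.Ioi (c + L₁), G t) := by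
    have h1 := intervalIntegral.integral_Iic_add_Ioi (hGint.integrableOn (s := Set.Iic (c - L₁)))
      (hGint.integrableOn (s := Set.Ioi (c - L₁)))
    have h2 := intervalIntegral.integral_Ioi_sub_Ioi (hGint.integrableOn (s := Set.Ioi (c - L₁)))
      (by linarith : c - L₁ ≤ c + L₁)
    have h3 : ∫ t in (c - L₁)..(c + L₁), G t = ∫ v in (-L₁)..L₁, G (v + c) := by
      rw [intervalIntegral.integral_comp_add_right G c]
      congr 1 <;> ring
    rw [← h1, ← h3]
    have h2' : ∫ t in Set.Ioi (c - L₁), G t =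
        (∫ t in (c - L₁)..(c + L₁), G t) + ∫ t in Set.Ioi (c + L₁), G t := by
      rw [← h2]; ring
    rw [h2']
  -- the two tails
  set γ : ℝ := L₁ / (8 * ell2 D ^ 2) with hγ
  have h8 : 0 < 8 * ell2 D ^ 2 := mul_pos (by norm_num) (pow_pos hℓ₂ 2)
  have hγ0 : 0 < γ := by
    rw [hγ]
    refine div_pos ?_ h8
    rw [hL₁, ell1]; exact pow_pos hℓ0 405
  have htailR : ‖∫ t in Set.Ioi (c + L₁), G t‖ ≤ K₃ * (Real.exp (-γ * L₁) / γ) := by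
    have hpt : ∀ t ∈ Set.Ioi (c + L₁), ‖G t‖ ≤ K₃ * Real.exp (γ * c) * Real.exp (-γ * t) := by
      intro t ht
      have htc : L₁ ≤ t - c := by have := Set.mem_Ioi.mp ht; linarith
      refine (hGbd t).trans ?_
      rw [show K₃ * Real.exp (γ * c) * Real.exp (-γ * t) = K₃ * Real.exp (γ * c + -γ * t) by
        rw [Real.exp_add]; ring]
      apply mul_le_mul_of_nonneg_left _ hK₃0
      apply Real.exp_le_exp.mpr
      have key : L₁ * (t - c) ≤ (t - c) ^ 2 := by nlinarith
      have h1 : -(1 / (8 * ell2 D ^ 2)) * (t - c) ^ 2 ≤ -(L₁ / (8 * ell2 D ^ 2)) * (t - c) := by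
        rw [show -(1 / (8 * ell2 D ^ 2)) * (t - c) ^ 2 = -((t - c) ^ 2) / (8 * ell2 D ^ 2) by ring,
          show -(L₁ / (8 * ell2 D ^ 2)) * (t - c) = -(L₁ * (t - c)) / (8 * ell2 D ^ 2) by ring]
        exact div_le_div_of_nonneg_right (by linarith) h8.le
      have h2 : -(L₁ / (8 * ell2 D ^ 2)) * (t - c) = γ * c + -γ * t := by rw [hγ]; ring
      linarith
    have hgi : IntegrableOn (fun t => K₃ * Real.exp (γ * c) * Real.exp (-γ * t))
        (Set.Ioi (c + L₁)) :=
      (integrableOn_exp_mul_Ioi (by linarith : -γ < 0) _).const_mul _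
    have hb := norm_integral_le_of_norm_le hgi
      ((ae_restrict_iff' measurableSet_Ioi).mpr (ae_of_all _ hpt))
    refine hb.trans_eq ?_
    rw [integral_const_mul, integral_exp_mul_Ioi (by linarith : -γ < 0)]
    have : Real.exp (γ * c) * (-Real.exp (-γ * (c + L₁)) / -γ) = Real.exp (-γ * L₁) / γ := by
      rw [neg_div_neg_eq, ← mul_div_assoc, ← Real.exp_add]
      congr 1; ring_nf
    rw [mul_assoc, this]
  have htailL : ‖∫ t in Set.Iic (c - L₁), G t‖ ≤ K₃ * (Real.exp (-γ * L₁) / γ) := by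
    have hpt : ∀ t ∈ Set.Iic (c - L₁), ‖G t‖ ≤ K₃ * Real.exp (-γ * c) * Real.exp (γ * t) := by
      intro t ht
      have htc : L₁ ≤ c - t := by have := Set.mem_Iic.mp ht; linarith
      refine (hGbd t).trans ?_
      rw [show K₃ * Real.exp (-γ * c) * Real.exp (γ * t) = K₃ * Real.exp (-γ * c + γ * t) by
        rw [Real.exp_add]; ring]
      apply mul_le_mul_of_nonneg_left _ hK₃0
      apply Real.exp_le_exp.mpr
      have key : L₁ * (c - t) ≤ (t - c) ^ 2 := by nlinarith
      have h1 : -(1 / (8 * ell2 D ^ 2)) * (t - c) ^ 2 ≤ -(L₁ / (8 * ell2 D ^ 2)) * (c - t) := by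
        rw [show -(1 / (8 * ell2 D ^ 2)) * (t - c) ^ 2 = -((t - c) ^ 2) / (8 * ell2 D ^ 2) by ring,
          show -(L₁ / (8 * ell2 D ^ 2)) * (c - t) = -(L₁ * (c - t)) / (8 * ell2 D ^ 2) by ring]
        exact div_le_div_of_nonneg_right (by linarith) h8.le
      have h2 : -(L₁ / (8 * ell2 D ^ 2)) * (c - t) = -γ * c + γ * t := by rw [hγ]; ring
      linarith
    have hgi : IntegrableOn (fun t => K₃ * Real.exp (-γ * c) * Real.exp (γ * t))
        (Set.Iic (c - L₁)) :=
      (integrableOn_exp_mul_Iic hγ0 _).const_mul _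
    have hb := norm_integral_le_of_norm_le hgi
      ((ae_restrict_iff' measurableSet_Iic).mpr (ae_of_all _ hpt))
    refine hb.trans_eq ?_
    rw [integral_const_mul, integral_exp_mul_Iic hγ0]
    have : Real.exp (-γ * c) * (Real.exp (γ * (c - L₁)) / γ) = Real.exp (-γ * L₁) / γ := by
      rw [← mul_div_assoc, ← Real.exp_add]
      congr 1; ring_nf
    rw [mul_assoc, this]
  -- the value of the tail majorant: `e^{−γ𝓛₁}/γ = 8𝓛³⁹⁵ e^{−𝓛¹⁰/8}`
  have hγval : Real.exp (-γ * L₁) / γ = 8 * ell D ^ 395 * Real.exp (-(ell D ^ 10) / 8) := by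
    have hℓne : ell D ≠ 0 := hℓ0.ne'
    have e1 : -γ * L₁ = -(ell D ^ 10) / 8 := by
      rw [hγ, hL₁, ell1, ell2]; field_simp
    have e2 : 1 / γ = 8 * ell D ^ 395 := by
      rw [hγ, hL₁, ell1, ell2]; field_simp
    rw [div_eq_mul_one_div, e1, e2]; ring
  -- assemble
  have hdiff : I1psi c' x a₁ a₂ - I1line c' x a₁ a₂ =
      (1 / (2 * π) : ℂ) * (((∫ v in (-L₁)..L₁, F v) - ∫ v in (-L₁)..L₁, G (v + c)) -
        (∫ t in Set.Iic (c - L₁), G t) - ∫ t in Set.Ioi (c + L₁), G t) := by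
    rw [hI1psi, hI1line, hsplit]; ring
  have hnormc : ‖(1 / (2 * π) : ℂ)‖ ≤ 1 := by
    rw [show (1 / (2 * π) : ℂ) = ((1 / (2 * π) : ℝ) : ℂ) by push_cast; ring, Complex.norm_real,
      Real.norm_of_nonneg (by positivity), div_le_one (by positivity)]
    linarith [Real.pi_gt_three]
  have hK3 := K3_le (B := B) hD9 x hS0
  have hpre := prefactor_le hℓ64
  have h395 : ell D ^ 395 ≤ ell D ^ 405 := Section6TailBounds.ell_pow_le_pow hD9 (by norm_num)
  have hexp519 : Real.exp (-(ell D ^ 519)) ≤ Real.exp (-(ell D ^ 10) / 8) := by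
    apply Real.exp_le_exp.mpr
    have : ell D ^ 10 ≤ ell D ^ 519 := Section6TailBounds.ell_pow_le_pow hD9 (by norm_num)
    linarith [pow_pos hℓ0 10]
  have hL₁abs : |L₁ - (-L₁)| = 2 * ell D ^ 405 := by
    rw [hL₁, ell1, sub_neg_eq_add, abs_of_nonneg (by positivity)]; ring
  have hE8 : 0 ≤ Real.exp (-(ell D ^ 10) / 8) := (Real.exp_pos _).le
  rw [hdiff, norm_mul]
  calc ‖(1 / (2 * π) : ℂ)‖ * ‖((∫ v in (-L₁)..L₁, F v) - ∫ v in (-L₁)..L₁, G (v + c)) -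
          (∫ t in Set.Iic (c - L₁), G t) - ∫ t in Set.Ioi (c + L₁), G t‖
      ≤ 1 * (‖(∫ v in (-L₁)..L₁, F v) - ∫ v in (-L₁)..L₁, G (v + c)‖ +
          ‖∫ t in Set.Iic (c - L₁), G t‖ + ‖∫ t in Set.Ioi (c + L₁), G t‖) := by
        apply mul_le_mul hnormc _ (norm_nonneg _) zero_le_one
        exact (norm_sub_le _ _).trans (add_le_add (norm_sub_le _ _) le_rfl)
    _ ≤ 9 * K₃ * Real.exp (-(ell D ^ 519)) * |L₁ - (-L₁)| +
          K₃ * (Real.exp (-γ * L₁) / γ) + K₃ * (Real.exp (-γ * L₁) / γ) := by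
        rw [one_mul]; exact add_le_add (add_le_add hsegInt htailL) htailR
    _ = K₃ * (18 * ell D ^ 405 * Real.exp (-(ell D ^ 519)) +
          16 * ell D ^ 395 * Real.exp (-(ell D ^ 10) / 8)) := by rw [hγval, hL₁abs]; ring
    _ ≤ K₃ * (18 * ell D ^ 405 * Real.exp (-(ell D ^ 10) / 8) +
          16 * ell D ^ 405 * Real.exp (-(ell D ^ 10) / 8)) := by
        apply mul_le_mul_of_nonneg_left _ hK₃0
        gcongr
    _ = 34 * (K₃ * ell D ^ 405 * Real.exp (-(ell D ^ 10) / 8)) := by ring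
    _ ≤ 34 * ((36 * 144 * Real.exp 1 * π ^ 2 * S * B ^ 2 * bigP D ^ (5 / 2 : ℝ) * ell D ^ 1038) *
          ell D ^ 405 * Real.exp (-(ell D ^ 10) / 8)) := by
        gcongr
    _ = 34 * 36 * 144 * Real.exp 1 * π ^ 2 * S * B ^ 2 *
          (bigP D ^ (5 / 2 : ℝ) * ell D ^ 1443 * Real.exp (-(ell D ^ 10) / 8)) := by ring
    _ ≤ 34 * 36 * 144 * Real.exp 1 * π ^ 2 * S * B ^ 2 * Real.exp (-(1 / 16) * ell D ^ 10) := by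
        apply mul_le_mul_of_nonneg_left hpre
        have h0 : (0 : ℝ) ≤ 34 * 36 * 144 * Real.exp 1 * π ^ 2 :=
          mul_nonneg (mul_nonneg (by norm_num) (Real.exp_pos _).le) (sq_nonneg π)
        exact mul_nonneg (mul_nonneg h0 hS0) (sq_nonneg B)

/-- `Step7u021` — `_holds` alias of `step7u021_holds` above under the fact's exact name (appended
2026-08-28, D-0026 bookkeeping: the proof term is the existing theorem of this file; no statement,
definition or attribute is edited; no new named fact; the ledger's debt table listed the fact
unproved). [cite: Zhang2022LandauSiegel, §7 p. 35, tex L1920] -/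
theorem _root_.Literature.NumberTheory.LFunctions.Zhang2022.Section7bStatements.Step7u021_holds :
    Step7u021 c' :=
  _root_.Literature.NumberTheory.LFunctions.Zhang2022.Section7I1Line.step7u021_holds (c' := c')

/-- **`Z22:§7.u022` DISCHARGED outright** (§7 p. 35, tex L1921–1924, "Thus, integration term-by-term
gives `I₁(ψ) = (τ(ψ̄)/p)Σ_mΣ_n (κ∗a₁)(m)a₂(n)ψ(m)ψ̄(n)n⁻¹Δ₁(m/(pn)) + O(ε)`"): composing the tree's
edge `Section7I1Termwise.step7u022_of_step7u021` (sz-d03; exact term-by-term identity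
`I1line = I1termwise`) with `step7u021_holds`. [cite: Zhang2022LandauSiegel, §7 p. 35, tex L1921] -/
theorem step7u022_holds : Step7u022 c' :=
  Section7I1Termwise.step7u022_of_step7u021 c' (step7u021_holds c')

/-- `Step7u022` — `_holds` alias of `step7u022_holds` above under the fact's exact name (appended
2026-08-28, D-0026 bookkeeping: the proof term is the existing theorem of this file; no statement,
definition or attribute is edited; no new named fact; the ledger's debt table listed the fact
unproved). [cite: Zhang2022LandauSiegel, §7 p. 35, tex L1921] -/
theorem _root_.Literature.NumberTheory.LFunctions.Zhang2022.Section7bStatements.Step7u022_holds :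
    Step7u022 c' :=
  _root_.Literature.NumberTheory.LFunctions.Zhang2022.Section7I1Line.step7u022_holds (c' := c')

end Literature.NumberTheory.LFunctions.Zhang2022.Section7I1Line
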